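import Summits.QuantumFields.YangMills.Theses.OneCertifiedCube
import Literature.MathematicalPhysics.QuantumLattice.LatticeGaugeDLRBoxKernels

/-!
# `SU2OneCube` — the finite-size condition is void for cell unions not reaching the cube boundary

Route `OneCertifiedCube` of `YangMills`, support item `stmt-QuantumFields-8897`
(`Summit.QuantumFields.YangMills.Theses.OneCertifiedCube.SU2OneCube`). The TV finite-size
condition shared by `FiniteSizeCriterion`, `CrossoverCertificate` and `SU2OneCube` quantifies over
all cell unions `Λ_Y = ⋃_{y ∈ Y} cell(w, y)`, `Y ⊆ {-2n,…,2n}^4`, `0 ∈ Y`, of a frame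
`w : Fin 4 → ℤ → ℤ`, and over pairs of boundary conditions `η, η'` that agree on the edges of the
whole cube of `(4n+1)^4` cells. This file isolates the elementary part of that condition:

* `collar_subset_cells` — **range-one geometry**: for a strictly increasing frame and
  `Y ⊆ {-M+1,…,M-1}^d`, every edge of a plaquette touching `Λ_Y` (the collar of `Λ_Y`, the
  support of the boundary Wilson action) is an edge of a cell with index in `{-M,…,M}^d`;
* `integral_ymSpecification_eq_of_interior` — hence, by quasilocality of the lattice Yang–Mills
  kernels (`Literature.MathematicalPhysics.QuantumLattice.dependsOn_integral_ymSpecification`,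
  Georgii 2011 (2.15)), for such `Y` the kernel averages `∫ F dγ_{Λ_Y}(· | η)` of any measurable
  cylinder observable supported in the cube agree for all `η, η'` agreeing on the cube: the
  influence is exactly `0`, for every compact (second countable) `G`, continuous `ρ` and real `β`;
* `su2OneCube_inner_of_interior` — the literal inner inequality of `SU2OneCube` (`n = 1`,
  `ε = 1/2000`, `G = SU(2)`, fundamental representation) for every `β`, every `b ≥ 1`, every
  `[b, 2b]`-frame and every `Y ⊆ {-1, 0, 1}^4`.

So the content of `SU2OneCube` (and of the finite-size condition in general) is carried entirely
by the cell unions `Y` that reach the boundary layer `‖y‖_∞ = 2n` of the cube, where the collar of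
`Λ_Y` leaves the cube and reads the differing exterior data. No definition is introduced; the cell
and cube edge sets are written exactly as in the route file.

Sources: H.-O. Georgii, *Gibbs Measures and Phase Transitions* (2011), (2.15) (quasilocality of
finite-range specifications); E. Seiler, LNP 159 (1982), Ch. 2 (the Wilson action has range one).
-/

noncomputable section

open MeasureTheory
open Literature.MathematicalPhysics.QuantumLattice Literature.Probability.LatticeModels

namespace Summit.QuantumFields.YangMills.Theorems

namespace SU2OneCubeInteriorCells

/-! ### Geometry of cell frames -/

section Geometry

variable {d : ℕ}

/-- In a strictly increasing one-dimensional frame `v`, an integer within distance `1` of the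
cell `[v j, v (j+1))` lies in one of the cells `j - 1`, `j`, `j + 1`. [folklore] -/
theorem exists_cell_of_near {v : ℤ → ℤ} (hv : ∀ j, v j + 1 ≤ v (j + 1)) {j s t : ℤ}
    (hs : v j ≤ s ∧ s < v (j + 1)) (ht : s - 1 ≤ t ∧ t ≤ s + 1) :
    ∃ k, j - 1 ≤ k ∧ k ≤ j + 1 ∧ v k ≤ t ∧ t < v (k + 1) := by
  by_cases h1 : t < v j
  · have h := hv (j - 1)
    rw [sub_add_cancel] at h
    exact ⟨j - 1, le_rfl, by omega, by omega, by rw [sub_add_cancel]; exact h1⟩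
  · by_cases h2 : t < v (j + 1)
    · exact ⟨j, by omega, by omega, not_lt.1 h1, h2⟩
    · have h := hv (j + 1)
      exact ⟨j + 1, by omega, le_rfl, not_lt.1 h2, by omega⟩

/-- Membership in a union of cells of the frame `w`: the edge `e = (x, i)` lies in
`⋃_{y ∈ T} cell(w, y)` iff its base point `x` lies in the site box of some `y ∈ T`. [folklore] -/
theorem mem_cells_iff {w : Fin d → ℤ → ℤ} {T : Finset (Fin d → ℤ)} {e : ZdEdge d} :
    e ∈ T.biUnion (fun y : Fin d → ℤ =>
        (Fintype.piFinset fun i : Fin d => Finset.Ico (w i (y i)) (w i (y i + 1))) ×ˢ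
          (Finset.univ : Finset (Fin d))) ↔
      ∃ y ∈ T, ∀ i, w i (y i) ≤ e.1 i ∧ e.1 i < w i (y i + 1) := by
  simp only [Finset.mem_biUnion, Finset.mem_product, Fintype.mem_piFinset, Finset.mem_Ico,
    Finset.mem_univ, and_true]

/-- **Range-one geometry of cell unions.** For a strictly increasing frame `w` and cell indices
`Y ⊆ {-M+1,…,M-1}^d`, every edge of a plaquette touching `Λ_Y = ⋃_{y ∈ Y} cell(w, y)` is an edge
of a cell with index in `{-M,…,M}^d`: the collar of `Λ_Y` stays inside the cube of cells one
layer out (the Wilson action has range one, Seiler LNP 159 Ch. 2, and every cell has width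
`≥ 1`). [folklore] -/
theorem collar_subset_cells {w : Fin d → ℤ → ℤ} (hw : ∀ i j, w i j + 1 ≤ w i (j + 1)) {M : ℤ}
    {Y : Finset (Fin d → ℤ)} (hY : ∀ y ∈ Y, ∀ i, -M + 1 ≤ y i ∧ y i ≤ M - 1) :
    (plaquettesTouching (Y.biUnion fun y : Fin d → ℤ =>
        (Fintype.piFinset fun i : Fin d => Finset.Ico (w i (y i)) (w i (y i + 1))) ×ˢ
          (Finset.univ : Finset (Fin d)))).biUnion plaquetteEdges ⊆
      (Fintype.piFinset fun _ : Fin d => Finset.Icc (-M) M).biUnion fun y : Fin d → ℤ =>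
        (Fintype.piFinset fun i : Fin d => Finset.Ico (w i (y i)) (w i (y i + 1))) ×ˢ
          (Finset.univ : Finset (Fin d)) := by
  intro e he
  obtain ⟨e', he', hnear⟩ := exists_near_of_mem_collar he
  obtain ⟨y, hy, hy'⟩ := mem_cells_iff.1 he'
  have key : ∀ i, ∃ k, -M ≤ k ∧ k ≤ M ∧ w i k ≤ e.1 i ∧ e.1 i < w i (k + 1) := by
    intro i
    obtain ⟨k, hk1, hk2, hk3, hk4⟩ := exists_cell_of_near (hw i) (hy' i) (hnear i)
    have hyi := hY y hy i
    exact ⟨k, by omega, by omega, hk3, hk4⟩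
  choose z hz using key
  refine mem_cells_iff.2 ⟨z, ?_, fun i => ⟨(hz i).2.2.1, (hz i).2.2.2⟩⟩
  simp only [Fintype.mem_piFinset, Finset.mem_Icc]
  exact fun i => ⟨(hz i).1, (hz i).2.1⟩

end Geometry

/-! ### Zero influence for interior cell unions -/

section Kernel

variable {d N : ℕ} {G : Type*} [Group G] [TopologicalSpace G] [IsTopologicalGroup G]
  [CompactSpace G] [MeasurableSpace G] [BorelSpace G] [SecondCountableTopology G]

/-- **The finite-size influence vanishes for interior cell unions.** For a compact second
countable group `G`, a continuous matrix representation `ρ`, any real `β`, a strictly increasing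
frame `w`, cell indices `Y ⊆ {-M+1,…,M-1}^d` and an observable `F` that is a measurable cylinder
function supported in the cube of cells `{-M,…,M}^d`: if two boundary conditions `η, η'` agree on
the edges of that cube, then `∫ F dγ_{Λ_Y}(· | η) = ∫ F dγ_{Λ_Y}(· | η')` for the lattice
Yang–Mills kernels `γ = ymSpecification ρ β` — quasilocality (Georgii 2011, (2.15);
`dependsOn_integral_ymSpecification`) together with `collar_subset_cells`. [folklore] -/
theorem integral_ymSpecification_eq_of_interior (ρ : G →* Matrix (Fin N) (Fin N) ℂ)
    (hρ : Continuous ρ) (β : ℝ) {w : Fin d → ℤ → ℤ} (hw : ∀ i j, w i j + 1 ≤ w i (j + 1))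
    {M : ℤ} {Y : Finset (Fin d → ℤ)} (hY : ∀ y ∈ Y, ∀ i, -M + 1 ≤ y i ∧ y i ≤ M - 1)
    {S₀ : Finset (ZdEdge d)}
    (hS₀ : S₀ ⊆ (Fintype.piFinset fun _ : Fin d => Finset.Icc (-M) M).biUnion fun y : Fin d → ℤ =>
        (Fintype.piFinset fun i : Fin d => Finset.Ico (w i (y i)) (w i (y i + 1))) ×ˢ
          (Finset.univ : Finset (Fin d)))
    {η η' : LGConfig d G}
    (hηη' : ∀ e ∈ (Fintype.piFinset fun _ : Fin d => Finset.Icc (-M) M).biUnion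
        (fun y : Fin d → ℤ =>
          (Fintype.piFinset fun i : Fin d => Finset.Ico (w i (y i)) (w i (y i + 1))) ×ˢ
            (Finset.univ : Finset (Fin d))), η e = η' e)
    {F : LGConfig d G → ℝ} (hFm : Measurable F) (hF : IsCylinder F S₀) :
    ∫ U, F U ∂(ymSpecification ρ β (Y.biUnion fun y : Fin d → ℤ =>
        (Fintype.piFinset fun i : Fin d => Finset.Ico (w i (y i)) (w i (y i + 1))) ×ˢ
          (Finset.univ : Finset (Fin d))) η) =
      ∫ U, F U ∂(ymSpecification ρ β (Y.biUnion fun y : Fin d → ℤ =>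
        (Fintype.piFinset fun i : Fin d => Finset.Ico (w i (y i)) (w i (y i + 1))) ×ˢ
          (Finset.univ : Finset (Fin d))) η') := by
  refine dependsOn_integral_ymSpecification ρ hρ β _ hFm hF fun e he => hηη' e ?_
  rcases Finset.mem_union.1 (Finset.mem_coe.1 he) with h | h
  · exact hS₀ h
  · exact collar_subset_cells hw hY h

end Kernel

/-! ### The literal inner statement of `SU2OneCube` for interior `Y` -/

/-- **`SU2OneCube` holds trivially off the boundary layer.** For `G = SU(2)` in the fundamental
representation, every real `β`, every `b ≥ 1`, every `[b, 2b]`-frame `w`, every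
`Y ⊆ {-1, 0, 1}^4`, every pair of boundary conditions agreeing on the edges of the cube of `5^4`
cells and every measurable cylinder function `f` of the central cell, the two kernel averages in
`SU2OneCube` coincide, so their difference is `0 ≤ 1/2000` (the hypotheses `0 ∈ Y` and
`0 ≤ f ≤ 1` of the route statement are not needed). The whole content of the item therefore sits
in the `Y` meeting the layer `‖y‖_∞ = 2`. [folklore] -/
theorem su2OneCube_inner_of_interior (β : ℝ) (b : ℕ) (hb : 1 ≤ b) (w : Fin 4 → ℤ → ℤ)
    (hw : ∀ i j, w i j + ((b : ℕ) : ℤ) ≤ w i (j + 1) ∧ w i (j + 1) ≤ w i j + 2 * ((b : ℕ) : ℤ))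
    (Y : Finset (Fin 4 → ℤ)) (hY : Y ⊆ Fintype.piFinset fun _ : Fin 4 => Finset.Icc (-1 : ℤ) 1)
    (η η' : LGConfig 4 ↥(Matrix.specialUnitaryGroup (Fin 2) ℂ))
    (hηη' : ∀ e ∈ (Fintype.piFinset fun _ : Fin 4 =>
        Finset.Icc (-(2 * ((1 : ℕ) : ℤ))) (2 * ((1 : ℕ) : ℤ))).biUnion
          (fun y : Fin 4 → ℤ =>
            (Fintype.piFinset fun i : Fin 4 => Finset.Ico (w i (y i)) (w i (y i + 1))) ×ˢ
              (Finset.univ : Finset (Fin 4))), η e = η' e)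
    (f : LGConfig 4 ↥(Matrix.specialUnitaryGroup (Fin 2) ℂ) → ℝ)
    (hf : IsCylinder f ((fun y : Fin 4 → ℤ =>
        (Fintype.piFinset fun i : Fin 4 => Finset.Ico (w i (y i)) (w i (y i + 1))) ×ˢ
          (Finset.univ : Finset (Fin 4))) 0))
    (hfm : Measurable f) :
    |(∫ U, f U ∂(ymSpecification (fundamentalRep (Fin 2)) β (Y.biUnion (fun y : Fin 4 → ℤ =>
        (Fintype.piFinset fun i : Fin 4 => Finset.Ico (w i (y i)) (w i (y i + 1))) ×ˢ
          (Finset.univ : Finset (Fin 4)))) η)) -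
      ∫ U, f U ∂(ymSpecification (fundamentalRep (Fin 2)) β (Y.biUnion (fun y : Fin 4 → ℤ =>
        (Fintype.piFinset fun i : Fin 4 => Finset.Ico (w i (y i)) (w i (y i + 1))) ×ˢ
          (Finset.univ : Finset (Fin 4)))) η')| ≤ (1 : ℝ) / 2000 := by
  have hw1 : ∀ i j, w i j + 1 ≤ w i (j + 1) := fun i j => by
    have h := (hw i j).1
    have hb' : (1 : ℤ) ≤ ((b : ℕ) : ℤ) := by exact_mod_cast hb
    omega
  have h2 : (2 * ((1 : ℕ) : ℤ)) = 2 := by norm_num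
  have hY' : ∀ y ∈ Y, ∀ i, -(2 : ℤ) + 1 ≤ y i ∧ y i ≤ 2 - 1 := by
    intro y hy i
    have h := Fintype.mem_piFinset.1 (hY hy) i
    rw [Finset.mem_Icc] at h
    omega
  have hS₀ : ((fun y : Fin 4 → ℤ =>
        (Fintype.piFinset fun i : Fin 4 => Finset.Ico (w i (y i)) (w i (y i + 1))) ×ˢ
          (Finset.univ : Finset (Fin 4))) 0) ⊆
      (Fintype.piFinset fun _ : Fin 4 => Finset.Icc (-(2 : ℤ)) 2).biUnion fun y : Fin 4 → ℤ =>
        (Fintype.piFinset fun i : Fin 4 => Finset.Ico (w i (y i)) (w i (y i + 1))) ×ˢ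
          (Finset.univ : Finset (Fin 4)) :=
    Finset.subset_biUnion_of_mem (fun y : Fin 4 → ℤ =>
        (Fintype.piFinset fun i : Fin 4 => Finset.Ico (w i (y i)) (w i (y i + 1))) ×ˢ
          (Finset.univ : Finset (Fin 4))) (by simp [Fintype.mem_piFinset])
  rw [h2] at hηη'
  rw [integral_ymSpecification_eq_of_interior (fundamentalRep (Fin 2))
      (continuous_fundamentalRep (n := Fin 2)) β hw1 (M := 2) hY' hS₀ hηη' hfm hf,
    sub_self, abs_zero]
  norm_num

end SU2OneCubeInteriorCells

end Summit.QuantumFields.YangMills.Theorems
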